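import Literature.Probability.RandomPlanarGeometry.SAWCount
import Literature.Probability.Percolation.DualContours
import Mathlib.Topology.MetricSpace.HausdorffDistance
import Mathlib.Analysis.Convex.Segment
import Mathlib.Analysis.Complex.Basic

/-!
# Route `SAWEdgeOfPositiveType`, item `ConvexMetricUpgrade` (stmt-CriticalPhenomena-13964), part 2:
# the digital line

For any two sites `a, b ∈ ℤ²` there is a self-avoiding walk `a → b` with the minimal number
`n = ‖b − a‖₁ ≤ 2|b − a|` of steps all of whose vertices lie within distance `2` of the segment `[a, b]`
(`exists_digital_saw`): the monotone staircase `k ↦ (± (k − ⌊Qk/n⌋), ± ⌊Qk/n⌋)` (`Q = |q|`, signs those of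
`b − a = (p, q)`), whose `k`-th vertex is within `ℓ¹`-distance `< 2` of the point of parameter `k/n` on the
segment.  It supplies the positivity `Z^T(u,v) ≥ x_c^n > 0` of the tube kernels in the engine
`ConvexMetricTriangle → AveragedTubeMass → TubeLowerBound` (the junk value `log 0 = 0` makes the metric
triangle inequality blind to positivity, so an explicit confined walk is needed at every scale).

## References

* N. Madras, G. Slade, *The Self-Avoiding Walk* (1993), §1.2 [MadrasSlade1993].
-/

noncomputable section

namespace Summit.CriticalPhenomena.SAWScalingLimit.Theorems.ConvexMetricUpgrade

open Literature.Probability.LatticeModels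
open Literature.Probability.RandomPlanarGeometry Literature.Probability.RandomPlanarGeometry.SAW
open Literature.Probability.Percolation.Contour (site_ext)

/-! ### Arithmetic of the digital line -/

/-- The ordinate `⌊Q k / n⌋` of the digital line has steps `0` or `1` when `Q ≤ n`. [folklore] -/
theorem digital_step {Q n : ℕ} (hQ : Q ≤ n) (hn : 0 < n) (k : ℕ) :
    Q * (k + 1) / n = Q * k / n ∨ Q * (k + 1) / n = Q * k / n + 1 := by
  have h1 : Q * k / n ≤ Q * (k + 1) / n := Nat.div_le_div_right (Nat.mul_le_mul_left _ (Nat.le_succ k))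
  have h2 : Q * (k + 1) / n ≤ Q * k / n + 1 := by
    calc Q * (k + 1) / n = (Q * k + Q) / n := by rw [Nat.mul_succ]
      _ ≤ (Q * k + n) / n := Nat.div_le_div_right (by omega)
      _ = Q * k / n + 1 := Nat.add_div_right _ hn
  omega

/-- `⌊Q k / n⌋ ≤ k` when `Q ≤ n`. [folklore] -/
theorem digital_le {Q n : ℕ} (hQ : Q ≤ n) (k : ℕ) : Q * k / n ≤ k := by
  rcases Nat.eq_zero_or_pos n with rfl | hn
  · simp
  · calc Q * k / n ≤ n * k / n := Nat.div_le_div_right (Nat.mul_le_mul_right _ hQ)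
      _ = k := by rw [Nat.mul_comm, Nat.mul_div_cancel _ hn]

/-- If `Q = n > 0` the ordinate is `k` itself. [folklore] -/
theorem digital_eq_self {n : ℕ} (hn : 0 < n) (k : ℕ) : n * k / n = k :=
  Nat.mul_div_cancel_left k hn

/-- The sign of an integer has absolute value at most one (as a real number). [folklore] -/
theorem abs_cast_sign_le_one (p : ℤ) : |((p.sign : ℤ) : ℝ)| ≤ 1 := by
  rcases lt_trichotomy p 0 with h | rfl | h
  · rw [Int.sign_eq_neg_one_of_neg h]; norm_num
  · norm_num
  · rw [Int.sign_eq_one_of_pos h]; norm_num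

/-! ### The distance estimate -/

/-- **The `k`-th vertex of the digital line is within `2` of the segment.**  With `b − a = (p, q)`,
`P = |p|`, `Q = |q|`, `n = P + Q > 0`, `i ≤ n` and `y = ⌊Q i / n⌋`, the site `a + (sign p · (i − y), sign q · y)`
is within distance `2` of the point of parameter `i/n` on `[a, b]`: both coordinates differ from it by
`± (Q i / n − y) ∈ [0, 1)`. [folklore] -/
theorem infDist_digital_le (a b : Site 2) {n i y : ℕ} (hn : 0 < n) (hi : i ≤ n)
    (hPQ : ((b - a) 0).natAbs + ((b - a) 1).natAbs = n)
    (hy1 : y * n ≤ ((b - a) 1).natAbs * i) (hy2 : ((b - a) 1).natAbs * i < y * n + n) (hyi : y ≤ i)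
    (w : Site 2) (hw0 : w 0 = ((b - a) 0).sign * ((i - y : ℕ) : ℤ))
    (hw1 : w 1 = ((b - a) 1).sign * (y : ℤ)) :
    Metric.infDist (Site.toComplex (a + w)) (segment ℝ (Site.toComplex a) (Site.toComplex b)) ≤ 2 := by
  set p : ℤ := (b - a) 0 with hp
  set q : ℤ := (b - a) 1 with hq
  set t : ℝ := (i : ℝ) / n with ht
  have hnR : (0 : ℝ) < n := by exact_mod_cast hn
  have ht0 : 0 ≤ t := by positivity
  have ht1 : t ≤ 1 := by
    rw [ht, div_le_one hnR]; exact_mod_cast hi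
  -- the comparison point on the segment
  have hs : (1 - t) • Site.toComplex a + t • Site.toComplex b ∈ segment ℝ (Site.toComplex a) (Site.toComplex b) :=
    ⟨1 - t, t, by linarith, ht0, by ring, rfl⟩
  refine (Metric.infDist_le_dist_of_mem hs).trans ?_
  -- the deviation `D = Q i / n - y ∈ [0, 1)`
  set D : ℝ := (q.natAbs : ℝ) * i / n - y with hD
  have hD0 : 0 ≤ D := by
    have : (y : ℝ) * n ≤ (q.natAbs : ℝ) * i := by exact_mod_cast hy1
    rw [hD, sub_nonneg, le_div_iff₀ hnR]; exact this
  have hD1 : D < 1 := by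
    have : (q.natAbs : ℝ) * i < (y : ℝ) * n + n := by exact_mod_cast hy2
    rw [hD, sub_lt_iff_lt_add, div_lt_iff₀ hnR]; linarith
  -- coordinates of the difference vector
  have hpP : (p : ℝ) = (p.sign : ℝ) * (p.natAbs : ℝ) := by
    rw [Nat.cast_natAbs, Int.cast_abs]; exact_mod_cast (Int.sign_mul_abs p).symm
  have hqQ : (q : ℝ) = (q.sign : ℝ) * (q.natAbs : ℝ) := by
    rw [Nat.cast_natAbs, Int.cast_abs]; exact_mod_cast (Int.sign_mul_abs q).symm
  have hPn : (p.natAbs : ℝ) = n - q.natAbs := by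
    have : ((p.natAbs + q.natAbs : ℕ) : ℝ) = n := by exact_mod_cast hPQ
    push_cast at this; linarith
  have hxy : ((i - y : ℕ) : ℝ) = (i : ℝ) - y := by rw [Nat.cast_sub hyi]
  have hre : (Site.toComplex (a + w) - ((1 - t) • Site.toComplex a + t • Site.toComplex b)).re =
      (p.sign : ℝ) * D := by
    have e1 : (Site.toComplex (a + w) - ((1 - t) • Site.toComplex a + t • Site.toComplex b)).re =
        (w 0 : ℝ) - t * p := by
      simp [Site.toComplex, hp]; ring
    rw [e1, hw0]; push_cast; rw [hxy, hpP, hPn, hD, ht]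
    field_simp
    ring
  have him : (Site.toComplex (a + w) - ((1 - t) • Site.toComplex a + t • Site.toComplex b)).im =
      -((q.sign : ℝ) * D) := by
    have e1 : (Site.toComplex (a + w) - ((1 - t) • Site.toComplex a + t • Site.toComplex b)).im =
        (w 1 : ℝ) - t * q := by
      simp [Site.toComplex, hq]; ring
    rw [e1, hw1]; push_cast; rw [hqQ, hD, ht]
    field_simp
    ring
  rw [Complex.dist_eq]
  refine (Complex.norm_le_abs_re_add_abs_im _).trans ?_
  rw [hre, him, abs_neg, abs_mul, abs_mul, abs_of_nonneg hD0]
  have h1 := abs_cast_sign_le_one p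
  have h2 := abs_cast_sign_le_one q
  nlinarith [abs_nonneg ((p.sign : ℤ) : ℝ), abs_nonneg ((q.sign : ℤ) : ℝ)]

/-! ### The digital line is a confined self-avoiding walk -/

/-- **The digital line.**  For all `a, b ∈ ℤ²` there is an `n`-step self-avoiding walk `a → b`, `n ≤ 2|b − a|`,
all of whose vertices lie within distance `2` of the segment `[a, b]`. [folklore] -/
theorem exists_digital_saw (a b : Site 2) :
    ∃ (n : ℕ) (ω : ℕ → Site 2), ω ∈ Zd.sawFun 2 n (b - a) ∧
      (n : ℝ) ≤ 2 * dist (Site.toComplex a) (Site.toComplex b) ∧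
      ∀ i ≤ n, Metric.infDist (Site.toComplex (a + ω i))
        (segment ℝ (Site.toComplex a) (Site.toComplex b)) ≤ 2 := by
  set p : ℤ := (b - a) 0 with hp
  set q : ℤ := (b - a) 1 with hq
  set P : ℕ := p.natAbs with hP
  set Q : ℕ := q.natAbs with hQ
  set n : ℕ := P + Q with hn
  have hQn : Q ≤ n := by omega
  -- ordinate and walk
  set y : ℕ → ℕ := fun k => Q * min k n / n with hy
  have hyle : ∀ k, y k ≤ min k n := fun k => digital_le hQn _
  set ω : ℕ → Site 2 := fun k => ![p.sign * ((min k n - y k : ℕ) : ℤ), q.sign * (y k : ℤ)] with hω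
  have hω0 : ∀ k, ω k 0 = p.sign * ((min k n - y k : ℕ) : ℤ) := fun k => by simp [hω]
  have hω1 : ∀ k, ω k 1 = q.sign * (y k : ℤ) := fun k => by simp [hω]
  -- absolute values of the coordinates
  have habs0 : ∀ k, (ω k 0).natAbs = min k n - y k := by
    intro k
    rw [hω0, Int.natAbs_mul, Int.natAbs_natCast]
    rcases eq_or_ne p 0 with hp0 | hp0
    · have hP0 : P = 0 := by rw [hP, hp0]; rfl
      have hyk : y k = min k n := by
        rcases Nat.eq_zero_or_pos n with hn0 | hnpos
        · have : min k n = 0 := by omega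
          simp [hy, this]
        · have hnQ : n = Q := by omega
          show Q * min k n / n = min k n
          rw [← hnQ]; exact digital_eq_self hnpos _
      rw [hyk, hp0]; simp
    · rw [Int.natAbs_sign_of_ne_zero hp0, one_mul]
  have habs1 : ∀ k, (ω k 1).natAbs = y k := by
    intro k
    rw [hω1, Int.natAbs_mul, Int.natAbs_natCast]
    rcases eq_or_ne q 0 with hq0 | hq0
    · have hQ0 : Q = 0 := by rw [hQ, hq0]; rfl
      have : y k = 0 := by simp [hy, hQ0]
      rw [this, hq0]; simp
    · rw [Int.natAbs_sign_of_ne_zero hq0, one_mul]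
  refine ⟨n, ω, Zd.mem_sawFun.2 ⟨?_, ?_, ?_, ?_⟩, ?_, ?_⟩
  · -- start at the origin
    refine site_ext ?_ ?_
    · rw [hω0]; simp
    · rw [hω1]; simp [hy]
  · -- frozen at `b - a` from time `n` on
    intro k hk
    have hmin : min k n = n := min_eq_right hk
    have hyn : y k = Q := by
      show Q * min k n / n = Q
      rw [hmin]
      rcases Nat.eq_zero_or_pos n with hn0 | hnpos
      · have hQ0 : Q = 0 := by omega
        rw [hQ0]; simp
      · exact Nat.mul_div_cancel Q hnpos
    refine site_ext ?_ ?_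
    · rw [hω0, hmin, hyn, show n - Q = P by omega, hP, Int.sign_mul_natAbs]
    · rw [hω1, hyn, hQ, Int.sign_mul_natAbs]
  · -- nearest-neighbour steps
    intro k hk
    have hnpos : 0 < n := by omega
    have hmin0 : min k n = k := min_eq_left hk.le
    have hmin1 : min (k + 1) n = k + 1 := min_eq_left hk
    have hy0 : y k = Q * k / n := by show Q * min k n / n = _; rw [hmin0]
    have hy1 : y (k + 1) = Q * (k + 1) / n := by show Q * min (k + 1) n / n = _; rw [hmin1]
    have hyk : y k ≤ k := by have := hyle k; rwa [hmin0] at this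
    have hyk1 : y (k + 1) ≤ k + 1 := by have := hyle (k + 1); rwa [hmin1] at this
    rw [zdGraph_adj_iff]
    rcases digital_step hQn hnpos k with hstep | hstep <;> rw [← hy1, ← hy0] at hstep
    · -- horizontal step: `p ≠ 0`
      have hp0 : p ≠ 0 := by
        intro hp0
        have hP0 : P = 0 := by rw [hP, hp0]; rfl
        have hnQ : n = Q := by omega
        have e0 : y k = k := by rw [hy0, ← hnQ]; exact digital_eq_self hnpos _
        have e1 : y (k + 1) = k + 1 := by rw [hy1, ← hnQ]; exact digital_eq_self hnpos _
        omega
      refine ⟨0, ?_⟩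
      rcases lt_or_gt_of_ne hp0 with hneg | hpos
      · right
        refine site_ext ?_ ?_
        · rw [Pi.add_apply, hω0, hω0, Pi.single_eq_same, hmin0, hmin1, Int.sign_eq_neg_one_of_neg hneg,
            hstep]
          omega
        · rw [Pi.add_apply, hω1, hω1, Pi.single_eq_of_ne (by decide : (1 : Fin 2) ≠ 0), hstep, add_zero]
      · left
        refine site_ext ?_ ?_
        · rw [Pi.add_apply, hω0, hω0, Pi.single_eq_same, hmin0, hmin1, Int.sign_eq_one_of_pos hpos, hstep]
          omega
        · rw [Pi.add_apply, hω1, hω1, Pi.single_eq_of_ne (by decide : (1 : Fin 2) ≠ 0), hstep, add_zero]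
    · -- vertical step: `q ≠ 0`
      have hq0 : q ≠ 0 := by
        intro hq0
        have hQ0 : Q = 0 := by rw [hQ, hq0]; rfl
        have e0 : y k = 0 := by rw [hy0, hQ0]; simp
        have e1 : y (k + 1) = 0 := by rw [hy1, hQ0]; simp
        omega
      refine ⟨1, ?_⟩
      rcases lt_or_gt_of_ne hq0 with hneg | hpos
      · right
        refine site_ext ?_ ?_
        · rw [Pi.add_apply, hω0, hω0, Pi.single_eq_of_ne (by decide : (0 : Fin 2) ≠ 1), hmin0, hmin1,
            hstep, Nat.add_sub_add_right, add_zero]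
        · rw [Pi.add_apply, hω1, hω1, Pi.single_eq_same, hstep, Int.sign_eq_neg_one_of_neg hneg]
          push_cast
          ring
      · left
        refine site_ext ?_ ?_
        · rw [Pi.add_apply, hω0, hω0, Pi.single_eq_of_ne (by decide : (0 : Fin 2) ≠ 1), hmin0, hmin1,
            hstep, Nat.add_sub_add_right, add_zero]
        · rw [Pi.add_apply, hω1, hω1, Pi.single_eq_same, hstep, Int.sign_eq_one_of_pos hpos]
          push_cast
          ring
  · -- self-avoidance: `|ω k 0| + |ω k 1| = k` on `[0, n]`
    intro i hi j hj hij
    simp only [Set.mem_setOf_eq] at hi hj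
    have key : ∀ k ≤ n, (ω k 0).natAbs + (ω k 1).natAbs = k := by
      intro k hk
      rw [habs0, habs1, min_eq_left hk]
      have := hyle k
      rw [min_eq_left hk] at this
      omega
    have h0 : (ω i 0).natAbs + (ω i 1).natAbs = (ω j 0).natAbs + (ω j 1).natAbs := by rw [hij]
    rwa [key i hi, key j hj] at h0
  · -- length `n = |p| + |q| ≤ 2 |b - a|`
    have hsub : Site.toComplex b - Site.toComplex a = Site.toComplex (b - a) :=
      Complex.ext (by simp [Site.toComplex]) (by simp [Site.toComplex])
    have h0 : |((p : ℤ) : ℝ)| ≤ dist (Site.toComplex a) (Site.toComplex b) := by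
      rw [dist_comm, Complex.dist_eq, hsub, hp]
      simpa [Site.toComplex] using Complex.abs_re_le_norm (Site.toComplex (b - a))
    have h1 : |((q : ℤ) : ℝ)| ≤ dist (Site.toComplex a) (Site.toComplex b) := by
      rw [dist_comm, Complex.dist_eq, hsub, hq]
      simpa [Site.toComplex] using Complex.abs_im_le_norm (Site.toComplex (b - a))
    have hPr : (P : ℝ) = |((p : ℤ) : ℝ)| := by rw [hP, Nat.cast_natAbs, Int.cast_abs]
    have hQr : (Q : ℝ) = |((q : ℤ) : ℝ)| := by rw [hQ, Nat.cast_natAbs, Int.cast_abs]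
    rw [hn]; push_cast; linarith
  · -- the distance estimate
    intro i hi
    rcases Nat.eq_zero_or_pos n with hn0 | hnpos
    · have hi0 : i = 0 := by omega
      subst hi0
      have hω00 : ω 0 = 0 := site_ext (by rw [hω0]; simp) (by rw [hω1]; simp [hy])
      rw [hω00, add_zero, Metric.infDist_zero_of_mem (left_mem_segment ℝ _ _)]
      norm_num
    · have hmin : min i n = i := min_eq_left hi
      have hyi : y i ≤ i := by have := hyle i; rwa [hmin] at this
      refine infDist_digital_le a b hnpos hi hn.symm (y := y i) ?_ ?_ hyi (ω i) ?_ ?_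
      · show Q * min i n / n * n ≤ Q * i
        rw [hmin]; exact Nat.div_mul_le_self _ _
      · show Q * i < Q * min i n / n * n + n
        rw [hmin]; exact Nat.lt_div_mul_add hnpos
      · rw [hω0, hmin]
      · rw [hω1]

end Summit.CriticalPhenomena.SAWScalingLimit.Theorems.ConvexMetricUpgrade

end
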